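import Summits.PneNP.PneNP.Theorems.ExpanderLinearGeneratorsColumnTwoFinalPrep

/-!
# PneNP / ExpanderLinearGenerators — `LinearGeneratorDepthFregeHard` at column weight two,
unconditionally

Route `PneNP/ExpanderLinearGenerators`, crux stmt-PneNP-11443
(`Summit.PneNP.PneNP.Theses.ExpanderLinearGenerators.LinearGeneratorDepthFregeHard`, Krajíček's
Problem 19.4.5 in universal-expander form). The crux quantifies over ALL `ℓ`-sparse unsolvable
systems over `𝔽₂` whose row supports form an `(n^{1-δ}, 3ℓ/4)`-boundary expander. This file
proves its conclusion — every depth-`d` `textbookFrege` refutation has size `≥ 2^{n^ε}` — under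
ONE extra hypothesis: every variable occurs in at most two equations (the Tseitin / graph case).
In print this slice follows from Galesi–Itsykson–Riazanov–Sofronova's treewidth theorem (in the
tree only as the named fact `galesiEtAl_tseitin_treewidth_depthFrege_lowerBound`, used
conditionally in `…LinearGeneratorDepthFregeHardTseitin`); here it is proved outright, by ROUTING
instead of switching lemmas:

1. an unsolvable system of column weight `≤ 2` has an odd closed component, and local boundary
   expansion makes every closed component large, locally sparse and locally vertex-expanding;
2. Krivelevich's extraction gives a dense core, and the Krivelevich–Sudakov iteration a clique
   minor of polynomial order `n^{Ω(1-δ)}` in every odd closed component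
   (`exists_minor_in_component`);
3. along the minor, the sum-encoding of the system projects, by one substitution of constant-size
   parity gadgets, onto the grid routing Tseitin system of the bijective pigeonhole principle
   (`exists_routing_subst` + `TextbookFrege.transfer_isDepthProofOf`), whose bounded-depth Frege
   refutations are exponentially long (`GridRouting.gridTseitin_depthFrege_lowerBound`, from the
   tree's `k`-evaluation lower bound for the onto pigeonhole principle).

* `linearGeneratorDepthFregeHard_of_colWeight_le_two` — the slice.

References: J. Krajíček, *Proof complexity* (CUP 2019), Problem 19.4.5; A. Urquhart, X. Fu,
*Simplified lower bounds for propositional proofs*, NDJFL 37 (1996); E. Ben-Sasson, *Hard examples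
for the bounded depth Frege proof system*, Comput. Complexity 11 (2002); M. Krivelevich, SIAM J.
Discrete Math. 32 (2018); M. Krivelevich, B. Sudakov, GAFA 19 (2009); N. Galesi, D. Itsykson,
A. Riazanov, A. Sofronova, APAL 174 (2023) (the treewidth form, for comparison).
-/

namespace Summit.PneNP.PneNP.Theorems.ColumnTwo

open Filter Finset Literature.Computability.MetaComplexity
open Literature.Computability.MetaComplexity.TextbookFrege
open Literature.Computability.Complexity (PropForm Clause CNF Literal)
open Literature.Computability.MetaComplexity.KrajicekRamsey (clauseOf)
open Summit.PneNP.PneNP.Theorems.GridRouting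

/-! ### The slice -/

/-- **`LinearGeneratorDepthFregeHard` at column weight `≤ 2`, unconditionally.** For every
`ℓ ≥ 1`, `0 < δ < 1` and depth `d` there are `ε > 0` and `N` such that for `n ≥ N`, every
system `E : Fin m → LinEqMod 2 n` over `𝔽₂` in which every variable occurs in at most two
equations, which is `ℓ`-sparse, whose row supports form an `(n^(1-δ), 3/4 · ℓ)`-boundary
expander and which is unsolvable, has no depth-`d` `textbookFrege` proof of
`¬(sumEncoding 1 E)` of size `< 2^(n^ε)`. This is the crux
`Summit.PneNP.PneNP.Theses.ExpanderLinearGenerators.LinearGeneratorDepthFregeHard` restricted by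
the one extra hypothesis `hcol`; proved by the routing reduction to the grid Tseitin system of the
bijective pigeonhole principle (no switching lemma). [Krajíček 2019, Problem 19.4.5 (column weight
two); Urquhart–Fu 1996; Ben-Sasson 2002; Krivelevich 2018; Krivelevich–Sudakov 2009] -/
theorem linearGeneratorDepthFregeHard_of_colWeight_le_two :
    ∀ (ℓ d : ℕ) (δ : ℝ), 1 ≤ ℓ → 0 < δ → δ < 1 → ∃ ε : ℝ, 0 < ε ∧ ∃ N : ℕ, ∀ n : ℕ, N ≤ n →
      ∀ (m : ℕ) (E : Fin m → LinEqMod 2 n),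
      (∀ j : Fin n, (Finset.univ.filter fun i => j ∈ (E i).supp).card ≤ 2) →
      (∀ i, (E i).supp.card ≤ ℓ) →
      IsBoundaryExpander (fun i => (E i).supp.map Fin.valEmbedding) ((n : ℝ) ^ (1 - δ)) (3 / 4 * ℓ) →
      ¬ SystemSat E Finset.univ →
      ∀ π : List (PropForm ℕ),
        textbookFrege.IsDepthProofOf d π (PropForm.neg (PropForm.ofCNF (sumEncoding 1 E))) →
          (2 : ℝ) ^ ((n : ℝ) ^ ε) ≤ (proofSize π : ℝ) := by
  intro ℓ d δ hℓ hδ hδ1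
  set α : ℝ := 1 - δ with hα
  have hα0 : 0 < α := by rw [hα]; linarith
  have hα1 : α ≤ 1 := by rw [hα]; linarith
  obtain ⟨ε₀, hε₀, K₁, hK₁⟩ := gridTseitin_depthFrege_lowerBound (d + 3 * 4 + 16)
  obtain ⟨N, hN⟩ := eventually_atTop.1 (eventually_params hα0 hα1 hε₀ K₁ transferConst)
  refine ⟨α * ε₀ / 10, by positivity, N, ?_⟩
  intro n hn m E hcol hsparse hexp hunsat π hπ
  obtain ⟨hn3, hvol0, hK₁k, h227, hT3, hk4, hrn⟩ := hN n hn
  classical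
  -- parameters
  set r : ℕ := ⌊(n : ℝ) ^ α⌋₊ with hr
  set kg : ℕ := ⌊(n : ℝ) ^ (α / 5)⌋₊ with hkg
  set Λ : ℕ := Nat.log 2 (2 * n) + 1 with hΛ
  set Kx : ℕ := 1000 * Λ * (Λ + 1) with hKx
  set s : ℕ := 2 * Kx * Λ with hs
  set t : ℕ := 4 * (Nat.log 2 r + 1) with ht
  set L : ℕ := 2 * (s + 1) + 2 * (t + 1) with hL
  set M : ℕ := nRows kg with hM
  set p : ℕ := 6 * M with hp
  set q : ℕ := 8 * p * L with hq
  set S : Fin m → Finset ℕ := fun i => (E i).supp.map Fin.valEmbedding with hS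
  -- basic facts
  have hn1 : (1 : ℝ) ≤ n := by exact_mod_cast (show 1 ≤ n by omega)
  have hR1 : (1 : ℝ) ≤ (n : ℝ) ^ α := Real.one_le_rpow hn1 hα0.le
  have hrR : (r : ℝ) ≤ (n : ℝ) ^ α := Nat.floor_le (by positivity)
  have hc : (0 : ℝ) < 3 / 4 * ℓ := mul_pos (by norm_num) (by exact_mod_cast hℓ)
  have hdeg : ∀ i, 0 < (E i).supp.card := fun i => by
    have := hexp.card_pos hc hR1 i
    rwa [Finset.card_map] at this
  have hm2n : m ≤ 2 * n := card_rows_le E hcol hdeg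
  have hmΛ : m < 2 ^ Λ := lt_of_le_of_lt hm2n (Nat.lt_pow_succ_log_self one_lt_two (2 * n))
  have hΛ1 : 1 ≤ Λ := by rw [hΛ]; omega
  have hKx1 : 1 ≤ Kx := by
    rw [hKx]
    refine Nat.one_le_iff_ne_zero.2 ?_
    simp only [ne_eq, Nat.mul_eq_zero, not_or]
    omega
  have hlogr : Nat.log 2 r + 1 ≤ Λ := by
    rw [hΛ]
    exact Nat.succ_le_succ (Nat.log_mono_right (hrn.trans (by omega)))
  have hM1 : 1 ≤ M := (nRows_bounds kg).2.2.2.1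
  have hvol : (12 * Kx + 3) * (p * q + p * p * L) + 3 ≤ r :=
    (vol_le hΛ1 hlogr rfl rfl rfl rfl rfl rfl).trans hvol0
  have hsrad : (2 * Kx) ^ s * m < (2 * Kx + 1) ^ s := linking_radius hKx1 hmΛ
  -- the clique minors in the odd closed components
  have hemb : ∀ K : Finset (Fin m), K.Nonempty → IsConn S K → boundary S K = ∅ →
      ∑ i ∈ K, (E i).2 = 1 → ∃ T : Fin M → Finset (Fin m),
        (∀ a, T a ⊆ K ∧ IsConn S (T a) ∧ (T a).Nonempty) ∧ (∀ a b, a ≠ b → Disjoint (T a) (T b)) ∧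
        (∀ a b, a ≠ b → ((gridSystem kg a).supp ∩ (gridSystem kg b).supp).Nonempty →
          ∃ i ∈ T a, ∃ j ∈ T b, (S i ∩ S j).Nonempty) := by
    intro K hKne hKc hKb _
    obtain ⟨T, hT1, hT2, hT3⟩ := exists_minor_in_component E hcol hsparse hℓ hexp hrR hR1 hmΛ hKne
      hKc hKb (four_pow_mul_lt r) hsrad rfl rfl hM1 hvol
    exact ⟨T, hT1, hT2, fun a b hab _ => hT3 a b hab⟩
  -- the routing substitution and the transfer
  obtain ⟨σ, hZ, hT, hloc⟩ := exists_routing_subst E (gridSystem kg) (k₀ := 4) hcol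
    (card_filter_mem_supp_gridSystem (k := kg)) (card_supp_gridSystem_le kg) (sum_gridSystem_snd kg) hemb
  obtain ⟨π', hπ', hsize⟩ := transfer_isDepthProofOf (sumEncoding 1 E) (sumEncoding 1 (gridSystem kg))
    σ (Zσ := 9 * 2 ^ 4) (Tσ := 3 * 4) (qq := 2 ^ 4) (k := 4) hZ (by norm_num) hT hπ hloc
  -- the grid lower bound
  have hlb := hK₁ kg hK₁k π' hπ'
  -- the size of the transferred proof
  have hms := msum_gridClauses_le (k := kg)
  have hsz : proofSize π' ≤ transferConst * (144 * proofSize π + 224 * M + 3) ^ 3 := by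
    refine hsize.trans ?_
    have h1 : transferLines (proofSize π) (proofSize π * (9 * 2 ^ 4) +
        msum ((sumEncoding 1 (gridSystem kg)).map clauseOf)) (2 ^ 4) 4 ≤
        transferLines (144 * proofSize π) (144 * proofSize π + 224 * M) 16 4 := by
      rw [show (2 ^ 4 : ℕ) = 16 by norm_num]
      exact transferLines_mono (by omega) (by omega)
    have h2 : 40 * ((2 ^ 4 + 3) * (proofSize π * (9 * 2 ^ 4) +
        msum ((sumEncoding 1 (gridSystem kg)).map clauseOf) + 3) + 4) + 300 ≤
        40 * (19 * (144 * proofSize π + 224 * M + 3) + 4) + 300 := by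
      norm_num
      omega
    exact (Nat.mul_le_mul h1 h2).trans (transferBound_le' (144 * proofSize π) M)
  -- conclude
  have hMn : M ≤ n := by
    have h1 : M ≤ (kg + 3) ^ 2 := (nRows_bounds kg).1
    have h2 : (kg + 3) ^ 2 ≤ (kg + 3) ^ 4 := Nat.pow_le_pow_right (by omega) (by norm_num)
    have hpos : 0 < 10 ^ 11 * Λ ^ 5 := Nat.mul_pos (Nat.pow_pos (by norm_num)) (Nat.pow_pos (by omega))
    have h3 : (kg + 3) ^ 4 ≤ 10 ^ 11 * Λ ^ 5 * (kg + 3) ^ 4 := Nat.le_mul_of_pos_left _ hpos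
    omega
  have hT0 : 0 < transferConst := by unfold transferConst; omega
  exact lb_arith hT0 hlb hsz hMn (by omega) h227 hT3 hk4

/-- **Corollary: the statement of `linearGeneratorDepthFregeHard_tseitin_of_galesiEtAl` holds
without the GIRS hypothesis** (and without connectedness): for `ℓ ≥ 1`, `0 < δ < 1`, depth `d`
there are `ε > 0`, `N` with: every `ℓ`-sparse unsolvable system `E` over `𝔽₂` in `n ≥ N`
variables, every variable in exactly two rows or none, whose row supports form an
`(n^(1-δ), 3/4 · ℓ)`-boundary expander, forces every depth-`d` `textbookFrege` proof of
`¬(sumEncoding 1 E)` to have size `≥ 2^(n^ε)` — for every row graph `G`, connected or not.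
[Krajíček 2019, Problem 19.4.5 (column weight two)] -/
theorem linearGeneratorDepthFregeHard_tseitin :
    ∀ (ℓ d : ℕ) (δ : ℝ), 1 ≤ ℓ → 0 < δ → δ < 1 → ∃ ε : ℝ, 0 < ε ∧ ∃ N : ℕ, ∀ n : ℕ, N ≤ n →
      ∀ (m : ℕ) (E : Fin m → LinEqMod 2 n), (∀ i, (E i).supp.card ≤ ℓ) →
      IsBoundaryExpander (fun i => (E i).supp.map Fin.valEmbedding) ((n : ℝ) ^ (1 - δ)) (3 / 4 * ℓ) →
      ¬ SystemSat E Finset.univ →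
      (∀ j : Fin n, (Finset.univ.filter fun i => j ∈ (E i).supp).card = 2 ∨
        (Finset.univ.filter fun i => j ∈ (E i).supp).card = 0) →
      ∀ G : SimpleGraph (Fin m),
        (∀ i i' : Fin m, G.Adj i i' ↔ i ≠ i' ∧ ((E i).supp ∩ (E i').supp).Nonempty) →
      ∀ π : List (PropForm ℕ),
        textbookFrege.IsDepthProofOf d π (PropForm.neg (PropForm.ofCNF (sumEncoding 1 E))) →
          (2 : ℝ) ^ ((n : ℝ) ^ ε) ≤ (proofSize π : ℝ) := by
  intro ℓ d δ hℓ hδ0 hδ1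
  obtain ⟨ε, hε, N, hN⟩ := linearGeneratorDepthFregeHard_of_colWeight_le_two ℓ d δ hℓ hδ0 hδ1
  refine ⟨ε, hε, N, fun n hn m E hsparse hexp hunsat htwo _ _ π hπ => ?_⟩
  refine hN n hn m E (fun j => ?_) hsparse hexp hunsat π hπ
  rcases htwo j with h | h <;> omega

end Summit.PneNP.PneNP.Theorems.ColumnTwo
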